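import Mathlib
import HarnessLib
import Summits.Schanuel.Schanuel.Theses.RealCoreRotationSplit

/-!
# Birth skeleton — crux `RealSchanuel` (stmt-Schanuel-19278) of route `RealCoreRotationSplit`

Line `birth` for the RESIDUAL conjunct SC_ℝ (`RealSchanuel := SchanuelProperty ℝ`): the
REAL-LOG SECTOR SPLIT of SC_ℝ, i.e. the sector engine of route GeodesicRealLogs restricted to
real tuples.

* `stub_realLogSector` — algebraic independence of ℚ-linearly independent REAL logarithms of
  algebraic numbers; verbatim `Summit.Schanuel.Schanuel.Theses.GeodesicRealLogs.RealLogSector`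
  (item stmt-Schanuel-11767), the INSIDE count.
* `stub_offRealLogReal` — Schanuel for REAL tuples relative to the real-log sector: a real tuple
  `x` (typed in `ℂ` with `im = 0`) that is ℚ-free modulo `span_ℚ 𝓛_ℝ`,
  `𝓛_ℝ = {z : ℂ | im z = 0 ∧ e^z ∈ ℚ̄}`, has `trdeg` at least `n` over the base
  `K₀⁺ = ℚ(𝓛_ℝ ∪ exp 𝓛_ℝ)` (the sector together with its — algebraic — exponentials); the
  OUTSIDE count (the off-sector count `GeodesicRealLogs.OffRealLogSector`, stmt-Schanuel-11768,
  restricted to real tuples, base enlarged by the algebraic set `exp 𝓛_ℝ`).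
* `RealSchanuel_of` — PROVED assembly: the sector engine (shape of
  `Literature.NumberTheory.Transcendental.schanuel_of_sector_split_set` and of this route's
  `closes`) run in `ℂ` at `E = span_ℚ 𝓛_ℝ = 𝓛_ℝ` (a ℚ-subspace: `e^{a+b} = e^a e^b`,
  `(e^{a/d})^d = e^a`, `IsAlgebraic.of_pow`), inside count by stub 1 transported along `ℝ ↪ ℂ`
  (`ExponentialRingHom.realComplex.lift_trdeg_adjoin_eq`, `AlgebraicIndependent.cardinalMk_le_trdeg`),
  outside count by stub 2 pushed down to `ℚ(y, e^y) ≤ K₀⁺` (`trdeg_adjoin_le_of_le`), tower law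
  (`add_le_trdeg_adjoin_union`), inclusion into `ℚ(x, e^x)` after clearing denominators, and
  transport of the total count back to `ℝ`.
-/

namespace Summit.Schanuel.Schanuel.Cruxes.RealSchanuel.Birth

/-- stub 1 (INSIDE the real-log sector) — algebraic independence of real logarithms: ℚ-linearly
independent real numbers `l₁ … lₙ` with `e^{lᵢ}` algebraic are algebraically independent over `ℚ`.
Verbatim `GeodesicRealLogs.RealLogSector` (stmt-Schanuel-11767); open for every `n ≥ 2`
(Waldschmidt2000 Conj. 1.15 restricted to `𝓛 ∩ ℝ`; Roy1995). -/
theorem stub_realLogSector :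
    ∀ (n : ℕ) (l : Fin n → ℝ), (∀ i, IsAlgebraic ℚ (Real.exp (l i))) → LinearIndependent ℚ l →
      AlgebraicIndependent ℚ l := by
  sorry

/-- stub 2 (OFF the real-log sector, real tuples) — Schanuel for real tuples relative to
`K₀⁺ = ℚ(𝓛_ℝ ∪ exp 𝓛_ℝ)`, `𝓛_ℝ = {z : ℂ | z.im = 0 ∧ e^z ∈ ℚ̄}`: if `x₁ … xₙ ∈ ℝ ⊂ ℂ` are
ℚ-linearly independent modulo `span_ℚ 𝓛_ℝ`, then `trdeg_{K₀⁺} K₀⁺(x, eˣ) ≥ n`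
(GeodesicRealLogs.OffRealLogSector = stmt-Schanuel-11768 restricted to real tuples; the base
change from `ℚ(𝓛_ℝ)` to `K₀⁺` is algebraic). Already `n = 1`, `x = (1)` says `e ∉ K₀⁺‾`
(open); Kirby2010EAEF Thm 1.2 counts only over `ecl`-closed bases. -/
theorem stub_offRealLogReal :
    ∀ (n : ℕ) (x : Fin n → ℂ), (∀ i, (x i).im = 0) →
      LinearIndependent ℚ
        ((Submodule.span ℚ {z : ℂ | z.im = 0 ∧ IsAlgebraic ℚ (Complex.exp z)}).mkQ ∘ x) →
      (n : Cardinal) ≤ Algebra.trdeg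
        ↥(IntermediateField.adjoin ℚ
            ({z : ℂ | z.im = 0 ∧ IsAlgebraic ℚ (Complex.exp z)} ∪
              Complex.exp '' {z : ℂ | z.im = 0 ∧ IsAlgebraic ℚ (Complex.exp z)}))
        ↥(IntermediateField.adjoin
            ↥(IntermediateField.adjoin ℚ
                ({z : ℂ | z.im = 0 ∧ IsAlgebraic ℚ (Complex.exp z)} ∪
                  Complex.exp '' {z : ℂ | z.im = 0 ∧ IsAlgebraic ℚ (Complex.exp z)}))
            (Set.range x ∪ Set.range (Complex.exp ∘ x))) := by
  sorry

/-! ### Stub statements by name (so that the composition's hypotheses are the stubs BY NAME) -/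

namespace Statement

/-- Statement of `stub_realLogSector`. -/
abbrev stub_realLogSector : Prop := type_of% @Birth.stub_realLogSector
/-- Statement of `stub_offRealLogReal`. -/
abbrev stub_offRealLogReal : Prop := type_of% @Birth.stub_offRealLogReal

end Statement

/-- COMPOSITION of line `birth` (kernel-checked, no `sorry`): `stub_realLogSector` →
`stub_offRealLogReal` → `RealSchanuel`, by the sector engine at `E = span_ℚ 𝓛_ℝ`
run in `ℂ` and transported back to `ℝ` along the E-ring embedding `ℝ ↪ ℂ`. -/
theorem RealSchanuel_of (hIn0 : Statement.stub_realLogSector)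
    (hOut0 : Statement.stub_offRealLogReal) :
    Summit.Schanuel.Schanuel.Theses.RealCoreRotationSplit.RealSchanuel := by
  classical
  show ∀ (n : ℕ) (x : Fin n → ℝ), LinearIndependent ℚ x →
    (n : Cardinal) ≤ Algebra.trdeg ℚ ↥(IntermediateField.adjoin ℚ
      (Set.range x ∪ Set.range (Literature.ModelTheory.ExponentialFields.ExponentialRing.exp ∘ x)))
  intro n xr hxr
  -- transport the goal to `ℂ` along the E-ring embedding `ℝ ↪ ℂ`
  have htr :=
    Literature.ModelTheory.ExponentialFields.ExponentialRingHom.realComplex.lift_trdeg_adjoin_eq xr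
  simp only [Cardinal.lift_id] at htr
  rw [htr]
  set x : Fin n → ℂ := fun i => ((xr i : ℝ) : ℂ) with hxdef
  have hx : LinearIndependent ℚ x :=
    hxr.map'
      (Literature.ModelTheory.ExponentialFields.ExponentialRingHom.realComplex.toRingHom.toRatAlgHom.toLinearMap)
      (LinearMap.ker_eq_bot.mpr
        (Literature.ModelTheory.ExponentialFields.ExponentialRingHom.realComplex.toRingHom.injective))
  have key : (n : Cardinal) ≤ Algebra.trdeg ℚ
      ↥(IntermediateField.adjoin ℚ (Set.range x ∪ Set.range (Complex.exp ∘ x))) := by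
    have hAC : ∀ {w : ℂ}, w ∈ algebraicClosure ℚ ℂ ↔ IsAlgebraic ℚ w := mem_algebraicClosure_iff
    -- the real-log sector `𝓛_ℝ ⊂ ℂ`, its span `E`, and the base `L = K₀⁺ = ℚ(𝓛_ℝ ∪ exp 𝓛_ℝ)`
    set Lr : Set ℂ := {z : ℂ | z.im = 0 ∧ IsAlgebraic ℚ (Complex.exp z)} with hLr
    set B : Set ℂ := Lr ∪ Complex.exp '' Lr with hB
    set E : Submodule ℚ ℂ := Submodule.span ℚ Lr with hE
    set L : IntermediateField ℚ ℂ := IntermediateField.adjoin ℚ B with hL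
    -- `𝓛_ℝ` is a `ℚ`-subspace of `ℂ`
    have hLr_zero : (0 : ℂ) ∈ Lr :=
      ⟨Complex.zero_im, by rw [Complex.exp_zero]; exact isAlgebraic_one⟩
    have hLr_add : ∀ a ∈ Lr, ∀ b ∈ Lr, a + b ∈ Lr := fun a ha b hb =>
      ⟨by rw [Complex.add_im, ha.1, hb.1, add_zero],
        by rw [Complex.exp_add]; exact ha.2.mul hb.2⟩
    have hLr_smul : ∀ (q : ℚ), ∀ a ∈ Lr, q • a ∈ Lr := by
      intro q a ha
      refine ⟨?_, ?_⟩
      · rw [Rat.smul_def, Complex.mul_im, Complex.ratCast_im, Complex.ratCast_re, ha.1]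
        ring
      · have hden : (q.den : ℂ) ≠ 0 := Nat.cast_ne_zero.mpr q.den_nz
        set w : ℂ := a / (q.den : ℂ) with hw
        have hw' : Complex.exp w ^ q.den = Complex.exp a := by
          rw [← Complex.exp_nat_mul, hw, mul_div_cancel₀ _ hden]
        have halgw : IsAlgebraic ℚ (Complex.exp w) := by
          refine IsAlgebraic.of_pow q.den_pos ?_
          rw [hw']
          exact ha.2
        have hqa : q • a = (q.num : ℂ) * w := by
          rw [Rat.smul_def, hw, Rat.cast_def, div_mul_eq_mul_div, ← mul_div_assoc]
        rw [hqa, Complex.exp_int_mul]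
        exact hAC.1 (zpow_mem (hAC.2 halgw) q.num)
    have hPsub : ∀ w ∈ E, w ∈ Lr := by
      intro w hw
      induction hw using Submodule.span_induction with
      | mem w hw => exact hw
      | zero => exact hLr_zero
      | add u v _ _ hu hv => exact hLr_add u hu v hv
      | smul q u _ hu => exact hLr_smul q u hu
    have hEL : ∀ w ∈ E, w ∈ L ∧ Complex.exp w ∈ L := by
      intro w hw
      have hw' := hPsub w hw
      exact ⟨IntermediateField.subset_adjoin ℚ B (Or.inl hw'),
        IntermediateField.subset_adjoin ℚ B (Or.inr ⟨w, hw', rfl⟩)⟩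
    -- INSIDE count: a `ℚ`-free tuple inside `E` is a real tuple of logarithms of algebraic
    -- numbers; stub 1 gives algebraic independence in `ℝ`, transported along `ℝ ↪ ℂ`
    have hIn : ∀ (k : ℕ) (y : Fin k → ℂ), (∀ i, y i ∈ E) → LinearIndependent ℚ y →
        (k : Cardinal) ≤ Algebra.trdeg ℚ
          ↥(IntermediateField.adjoin ℚ (Set.range y ∪ Set.range (Complex.exp ∘ y))) := by
      intro k y hyE hyli
      have hyLr : ∀ i, y i ∈ Lr := fun i => hPsub _ (hyE i)
      have hreal : ∀ i, ∃ r : ℝ, y i = (r : ℂ) := fun i =>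
        ⟨(y i).re, Complex.ext (by simp) (by simp [(hyLr i).1])⟩
      choose l hly using hreal
      have hy : y = fun i => ((l i : ℝ) : ℂ) := funext hly
      subst hy
      have halg : ∀ i, IsAlgebraic ℚ (Real.exp (l i)) := by
        intro i
        have h : IsAlgebraic ℚ (Complex.exp ((l i : ℝ) : ℂ)) := (hyLr i).2
        rw [← Complex.ofReal_exp] at h
        have h' : IsAlgebraic ℚ ((Complex.ofRealHom.toRatAlgHom) (Real.exp (l i))) := h
        exact (isAlgebraic_algHom_iff (Complex.ofRealHom.toRatAlgHom)
          (fun a b hab => Complex.ofReal_injective hab)).mp h'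
      have hl : LinearIndependent ℚ l :=
        LinearIndependent.of_comp
          (Literature.ModelTheory.ExponentialFields.ExponentialRingHom.realComplex.toRingHom.toRatAlgHom.toLinearMap)
          hyli
      have hAI : AlgebraicIndependent ℚ l := hIn0 k l halg hl
      have h1 : (k : Cardinal) ≤ Algebra.trdeg ℚ ↥(IntermediateField.adjoin ℚ
          (Set.range l ∪ Set.range (Literature.ModelTheory.ExponentialFields.ExponentialRing.exp ∘ l))) := by
        let Kl : IntermediateField ℚ ℝ := IntermediateField.adjoin ℚ
          (Set.range l ∪ Set.range (Literature.ModelTheory.ExponentialFields.ExponentialRing.exp ∘ l))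
        let l' : Fin k → Kl := fun i => ⟨l i, IntermediateField.subset_adjoin ℚ _ (Or.inl ⟨i, rfl⟩)⟩
        have hl' : AlgebraicIndependent ℚ l' :=
          AlgebraicIndependent.of_comp Kl.val (show AlgebraicIndependent ℚ (Kl.val ∘ l') from hAI)
        have := hl'.cardinalMk_le_trdeg
        rwa [Cardinal.mk_fin] at this
      have h2 :=
        Literature.ModelTheory.ExponentialFields.ExponentialRingHom.realComplex.lift_trdeg_adjoin_eq l
      simp only [Cardinal.lift_id] at h2
      rw [h2] at h1
      exact h1
    -- the tuple `x` is real, hence so is its `ℚ`-span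
    set V : Submodule ℚ ℂ := Submodule.span ℚ (Set.range x) with hV
    have hVreal : ∀ v ∈ V, v.im = 0 := by
      intro v hv
      induction hv using Submodule.span_induction with
      | mem w hw =>
        obtain ⟨i, rfl⟩ := hw
        exact Complex.ofReal_im _
      | zero => exact Complex.zero_im
      | add u v _ _ hu hv => rw [Complex.add_im, hu, hv, add_zero]
      | smul q u _ hu =>
        rw [Rat.smul_def, Complex.mul_im, hu, Complex.ratCast_im]
        ring
    -- the ENGINE: split `V = span_ℚ x` at `E`, count inside with exponentials (hIn) and outside
    -- over `L` (stub 2), add by the tower law, include into `ℚ(x, e^x)`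
    haveI : FiniteDimensional ℚ V := FiniteDimensional.span_of_finite ℚ (Set.finite_range x)
    obtain ⟨U', hU'⟩ := (V ⊓ E).exists_isCompl
    set W : Submodule ℚ ℂ := V ⊓ E
    set U : Submodule ℚ ℂ := V ⊓ U' with hU
    haveI : FiniteDimensional ℚ W := Submodule.finiteDimensional_of_le inf_le_left
    haveI : FiniteDimensional ℚ U := Submodule.finiteDimensional_of_le inf_le_left
    have hsup : W ⊔ U = V := by
      rw [hU, inf_comm, ← sup_inf_assoc_of_le U' (inf_le_left : W ≤ V), hU'.sup_eq_top, top_inf_eq]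
    have hdj : Disjoint W U := hU'.disjoint.mono_right inf_le_right
    have hUE : Disjoint U E := by
      rw [Submodule.disjoint_def]
      intro a haU haE
      exact (Submodule.disjoint_def.mp hdj) a ⟨inf_le_left (b := U') haU, haE⟩ haU
    set k := Module.finrank ℚ W
    set m := Module.finrank ℚ U
    have hn : k + m = n := by
      have h1 := Submodule.finrank_sup_add_finrank_inf_eq W U
      rw [hdj.eq_bot, finrank_bot, add_zero, hsup, hV, finrank_span_eq_card hx, Fintype.card_fin] at h1
      exact h1.symm
    let bW := Module.finBasis ℚ W
    let bU := Module.finBasis ℚ U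
    let y : Fin k → ℂ := fun i => bW i
    let z : Fin m → ℂ := fun j => bU j
    have hyli : LinearIndependent ℚ y := bW.linearIndependent.map' W.subtype W.ker_subtype
    have hzli : LinearIndependent ℚ z := bU.linearIndependent.map' U.subtype U.ker_subtype
    have hyE : ∀ i, y i ∈ E := fun i => (bW i).2.2
    have hyV : ∀ i, y i ∈ V := fun i => (bW i).2.1
    have hzU : ∀ j, z j ∈ U := fun j => (bU j).2
    have hzV : ∀ j, z j ∈ V := fun j => inf_le_left (b := U') (hzU j)
    -- clear denominators so that `y, z` (and their exponentials) lie in `ℚ(x, e^x)`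
    choose Ny hNy hNy_mem using fun i =>
      Literature.NumberTheory.Transcendental.exists_nsmul_mem_span_int x (hyV i)
    choose Nz hNz hNz_mem using fun j =>
      Literature.NumberTheory.Transcendental.exists_nsmul_mem_span_int x (hzV j)
    let cy : Fin k → ℚˣ := fun i => Units.mk0 (Ny i : ℚ) (Nat.cast_ne_zero.mpr (hNy i))
    let cz : Fin m → ℚˣ := fun j => Units.mk0 (Nz j : ℚ) (Nat.cast_ne_zero.mpr (hNz j))
    let y' : Fin k → ℂ := fun i => (Ny i : ℚ) • y i
    let z' : Fin m → ℂ := fun j => (Nz j : ℚ) • z j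
    have hy'_eq : cy • y = y' := by
      funext i; simp only [Pi.smul_apply', cy, y', Units.smul_def, Units.val_mk0]
    have hz'_eq : cz • z = z' := by
      funext j; simp only [Pi.smul_apply', cz, z', Units.smul_def, Units.val_mk0]
    have hy'li : LinearIndependent ℚ y' := hy'_eq ▸ hyli.units_smul cy
    have hz'li : LinearIndependent ℚ z' := hz'_eq ▸ hzli.units_smul cz
    have hy'E : ∀ i, y' i ∈ E := fun i => E.smul_mem _ (hyE i)
    have hz'U : ∀ j, z' j ∈ U := fun j => U.smul_mem _ (hzU j)
    have hz'V : ∀ j, z' j ∈ V := fun j => V.smul_mem _ (hzV j)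
    have hz'real : ∀ j, (z' j).im = 0 := fun j => hVreal _ (hz'V j)
    have hz'modE : LinearIndependent ℚ (E.mkQ ∘ z') := by
      refine hz'li.map ?_
      rw [Submodule.ker_mkQ]
      exact hUE.mono_left (Submodule.span_le.mpr (Set.range_subset_iff.mpr hz'U))
    -- the two counts and the tower
    set Sy : Set ℂ := Set.range y' ∪ Set.range (Complex.exp ∘ y') with hSy
    set Sz : Set ℂ := Set.range z' ∪ Set.range (Complex.exp ∘ z') with hSz
    set Ky : IntermediateField ℚ ℂ := IntermediateField.adjoin ℚ Sy with hKy
    have hk : (k : Cardinal) ≤ Algebra.trdeg ℚ Ky := hIn k y' hy'E hy'li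
    have hm₀ : (m : Cardinal) ≤ Algebra.trdeg L (IntermediateField.adjoin L Sz) :=
      hOut0 m z' hz'real hz'modE
    have hKyL : Ky ≤ L := by
      rw [hKy, IntermediateField.adjoin_le_iff]
      rintro a (⟨i, rfl⟩ | ⟨i, rfl⟩)
      · exact (hEL _ (hy'E i)).1
      · exact (hEL _ (hy'E i)).2
    have hm : (m : Cardinal) ≤ Algebra.trdeg Ky (IntermediateField.adjoin Ky Sz) :=
      hm₀.trans (Literature.NumberTheory.Transcendental.trdeg_adjoin_le_of_le hKyL Sz)
    have hkm : (k : Cardinal) + (m : Cardinal) ≤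
        Algebra.trdeg ℚ (IntermediateField.adjoin ℚ (Sy ∪ Sz)) :=
      Literature.NumberTheory.Transcendental.add_le_trdeg_adjoin_union Sy Sz hk hm
    set Kx : IntermediateField ℚ ℂ :=
      IntermediateField.adjoin ℚ (Set.range x ∪ Set.range (Complex.exp ∘ x)) with hKx
    have hle : IntermediateField.adjoin ℚ (Sy ∪ Sz) ≤ Kx := by
      rw [IntermediateField.adjoin_le_iff]
      rintro a ((⟨i, rfl⟩ | ⟨i, rfl⟩) | (⟨j, rfl⟩ | ⟨j, rfl⟩))
      · exact (Literature.NumberTheory.Transcendental.mem_adjoin_of_mem_span_int x (hNy_mem i)).1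
      · exact (Literature.NumberTheory.Transcendental.mem_adjoin_of_mem_span_int x (hNy_mem i)).2
      · exact (Literature.NumberTheory.Transcendental.mem_adjoin_of_mem_span_int x (hNz_mem j)).1
      · exact (Literature.NumberTheory.Transcendental.mem_adjoin_of_mem_span_int x (hNz_mem j)).2
    have hfin : Algebra.trdeg ℚ (IntermediateField.adjoin ℚ (Sy ∪ Sz)) ≤ Algebra.trdeg ℚ Kx :=
      trdeg_le_of_injective (IntermediateField.inclusion hle) (IntermediateField.inclusion_injective hle)
    calc (n : Cardinal) = (k : Cardinal) + (m : Cardinal) := by rw [← hn, Nat.cast_add]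
      _ ≤ Algebra.trdeg ℚ (IntermediateField.adjoin ℚ (Sy ∪ Sz)) := hkm
      _ ≤ Algebra.trdeg ℚ Kx := hfin
  exact key

/-- The crux along this line MODULO exactly the two registered stubs (depends on `sorryAx` only
through `stub_*`). -/
theorem RealSchanuel_proof : Summit.Schanuel.Schanuel.Theses.RealCoreRotationSplit.RealSchanuel :=
  RealSchanuel_of stub_realLogSector stub_offRealLogReal

end Summit.Schanuel.Schanuel.Cruxes.RealSchanuel.Birth
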